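import Literature.Probability.Process.StableLikeJumpChainLower
import HarnessLib

/-!
# Lower bounds for stable-like chains on `ℤ^d`: all times, and the off-diagonal regime

Support file for the proof of Bass–Levin 2002, Theorem 1.1
(`Literature.Probability.Process.bassLevin_thm_1_1`), continuing
`StableLikeJumpChainLower`. For a reversible stable-like Markov kernel `P` on `ℤ^d` with powers
`Q`, assuming the tail bound `∑_{‖z−x‖>r} Q k x z ≤ C_T k r^{-α}` (a consequence of the upper
bound, `kpow_far_le_of_offdiag`):

* `trunc_kpow_ball_ge_half` : the chain truncated at `ρ = A N^{1/α}` keeps mass `≥ 1/2` in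
  `B(v, A N^{1/α})` up to time `N`, once `(c₂ C + C_T) A^{-α} ≤ 1/2`;
* `kpow_near_diag_lower` : **near-diagonal lower bound** (Bass–Levin Prop. 5.1):
  for every `A' > 0` there is `c > 0` with `Q N x y ≥ c N^{-d/α}` for `N ≥ 2`, `‖x−y‖ ≤ A' N^{1/α}`
  (even times from `kpow_near_diag_lower_even`, odd times by one more step);
* `kpow_offdiag_lower` : **off-diagonal lower bound** (Bass–Levin Thm 5.2):
  `Q N x y ≥ c N ‖x−y‖^{-(d+α)}` for `‖x − y‖ ≥ A'' N^{1/α}`, `N ≥ 2`: in Meyer's decomposition,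
  the first long jump from `B(x, A N^{1/α})` (where the truncated chain sits with probability
  `≥ 1/2`) lands in `B(y, (N/2)^{1/α})` at rate `≥ c₁ (2‖x−y‖)^{-(d+α)}` per target point, after
  which the near-diagonal lower bound applies; summing over the `≥ N/2` possible jump times gives
  the factor `N`. This replaces the hitting-time/strong-Markov/Harnack argument of Bass–Levin.

[cite: BassLevin2002, Prop. 5.1, Thm 5.2]

## References
* R. F. Bass, D. A. Levin, *Transition probabilities for symmetric jump processes*,
  Trans. Amer. Math. Soc. 354 (2002) 2933–2953, §5.
-/

noncomputable section

namespace Literature.Probability.Process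

open scoped BigOperators

variable {d : ℕ} {P K₁ : (Fin d → ℤ) → (Fin d → ℤ) → ℝ}
  {Q R : ℕ → (Fin d → ℤ) → (Fin d → ℤ) → ℝ} {μ : (Fin d → ℤ) → ℝ} {m M c₁ c₂ α : ℝ}

/-- The lower kernel bound at distance `1` forces `c₁ ≤ 1`. [folklore] -/
theorem c_one_le_one (hd : 1 ≤ d) (hP0 : ∀ x y, 0 ≤ P x y) (hP1 : ∀ x, HasSum (P x) 1)
    (hlb : ∀ x y, c₁ * ‖x - y‖ ^ (-((d : ℝ) + α)) ≤ P x y) : c₁ ≤ 1 := by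
  have hPs : ∀ x, Summable (P x) := fun x => (hP1 x).summable
  have hP1' : ∀ x, ∑' y, P x y ≤ 1 := fun x => ((hP1 x).tsum_eq).le
  obtain ⟨i0⟩ : Nonempty (Fin d) := ⟨⟨0, hd⟩⟩
  set e : Fin d → ℤ := Pi.single i0 1 with he
  have hne : ‖e‖ = 1 := by rw [he, Pi.norm_single]; simp
  have h := hlb 0 e
  rw [zero_sub, norm_neg, hne, Real.one_rpow, mul_one] at h
  exact h.trans (kernel_le_one hP0 hPs hP1' 0 e)

/-- **Survival of the truncated chain, normalised form.** With `r₁ = A N^{1/α}`, `A ≥ 1`,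
`(c₂ 2^α(3^d+2d3^{d-1}/α) + C_T) A^{-α} ≤ 1/2` and the tail bound for `Q`, the chain with jumps
truncated at `r₁` started at `v` has mass `≥ 1/2` in `B(v, r₁)` at all times `k ≤ N`.
[folklore] -/
theorem trunc_kpow_ball_ge_half (hd : 1 ≤ d) (hα : 0 < α) (hP0 : ∀ x y, 0 ≤ P x y)
    (hP1 : ∀ x, HasSum (P x) 1)
    (hub : ∀ x y, P x y ≤ c₂ * ‖x - y‖ ^ (-((d : ℝ) + α))) (hc₂ : 0 ≤ c₂)
    (hQ0 : ∀ x y, Q 0 x y = if x = y then 1 else 0)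
    (hQ : ∀ n x y, Q (n + 1) x y = ∑' z, Q n x z * P z y)
    {C_T : ℝ} (hCT : 0 ≤ C_T)
    (htail : ∀ (k : ℕ) (x : Fin d → ℤ) (r : ℝ), 1 ≤ k → 0 < r →
      ∑' z, {z | r < ‖z - x‖}.indicator (Q k x) z ≤ C_T * k * r ^ (-α))
    {A : ℝ} (hA1 : 1 ≤ A)
    (hA : (c₂ * ((2 : ℝ) ^ α * (3 ^ d + 2 * d * 3 ^ (d - 1) / α)) + C_T) * A ^ (-α) ≤ 1 / 2)
    {N : ℕ} (hN : 1 ≤ N)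
    (hK₁ : ∀ w z, K₁ w z = if ‖w - z‖ ≤ A * (N : ℝ) ^ (1 / α) then P w z else 0)
    (hR0 : ∀ x y, R 0 x y = if x = y then 1 else 0)
    (hR : ∀ n x y, R (n + 1) x y = ∑' z, R n x z * K₁ z y)
    (v : Fin d → ℤ) (k : ℕ) (hk : k ≤ N) :
    (1 / 2 : ℝ) ≤ ∑' w, (Metric.closedBall v (A * (N : ℝ) ^ (1 / α))).indicator (R k v) w := by
  have hA0 : 0 < A := lt_of_lt_of_le one_pos hA1
  have hN0 : (0 : ℝ) < N := by exact_mod_cast hN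
  have hNα : 0 < (N : ℝ) ^ (1 / α) := Real.rpow_pos_of_pos hN0 _
  set Ct : ℝ := (2 : ℝ) ^ α * (3 ^ d + 2 * d * 3 ^ (d - 1) / α) with hCt
  have hCtnn : 0 ≤ Ct := by rw [hCt]; positivity
  set r₁ : ℝ := A * (N : ℝ) ^ (1 / α) with hr₁
  have hr₁0 : 0 < r₁ := mul_pos hA0 hNα
  have hpow1 : ((N : ℝ) ^ (1 / α)) ^ (-α) = (N : ℝ)⁻¹ := by
    rw [← Real.rpow_mul hN0.le, show (1 / α) * (-α) = -1 by field_simp, Real.rpow_neg_one]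
  have hr₁α : r₁ ^ (-α) = A ^ (-α) * (N : ℝ)⁻¹ := by
    rw [hr₁, Real.mul_rpow hA0.le hNα.le, hpow1]
  have hAα : 0 ≤ A ^ (-α) := Real.rpow_nonneg hA0.le _
  have hfar : ∑' z, {z | r₁ < ‖z - v‖}.indicator (Q k v) z ≤ C_T * A ^ (-α) := by
    rcases Nat.eq_zero_or_pos k with h0 | hkpos
    · subst h0; rw [kpow_far_zero hQ0 hr₁0.le v]; positivity
    · calc _ ≤ C_T * k * r₁ ^ (-α) := htail k v r₁ hkpos hr₁0
        _ ≤ C_T * N * r₁ ^ (-α) := by gcongr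
        _ = C_T * A ^ (-α) := by rw [hr₁α]; field_simp
  have hA' : c₂ * Ct * A ^ (-α) + C_T * A ^ (-α) ≤ 1 / 2 := by
    have : (c₂ * Ct + C_T) * A ^ (-α) = c₂ * Ct * A ^ (-α) + C_T * A ^ (-α) := by ring
    linarith [hA]
  have h := trunc_kpow_ball_ge hd hα hP0 hP1 hub hc₂ hr₁0 hK₁ hQ0 hQ hR0 hR k v r₁
  have h1 : (k : ℝ) * (c₂ * Ct * r₁ ^ (-α)) ≤ c₂ * Ct * A ^ (-α) := by
    calc (k : ℝ) * (c₂ * Ct * r₁ ^ (-α)) ≤ N * (c₂ * Ct * r₁ ^ (-α)) := by gcongr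
      _ = c₂ * Ct * A ^ (-α) := by rw [hr₁α]; field_simp
  linarith

/-- Under the same normalisation the far mass `∑_{‖z−v‖>A N^{1/α}} Q k v z` is at most
`C_T A^{-α} ≤ 1/2` for `k ≤ N`. [folklore] -/
theorem kpow_far_le_half (hα : 0 < α) (hQ0 : ∀ x y, Q 0 x y = if x = y then 1 else 0)
    {C_T c₂' : ℝ} (hCT : 0 ≤ C_T) (hc₂' : 0 ≤ c₂')
    (htail : ∀ (k : ℕ) (x : Fin d → ℤ) (r : ℝ), 1 ≤ k → 0 < r →
      ∑' z, {z | r < ‖z - x‖}.indicator (Q k x) z ≤ C_T * k * r ^ (-α))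
    {A : ℝ} (hA1 : 1 ≤ A) (hA : (c₂' + C_T) * A ^ (-α) ≤ 1 / 2)
    {N : ℕ} (hN : 1 ≤ N) (v : Fin d → ℤ) (k : ℕ) (hk : k ≤ N) :
    ∑' z, {z | A * (N : ℝ) ^ (1 / α) < ‖z - v‖}.indicator (Q k v) z ≤ C_T * A ^ (-α) ∧
      C_T * A ^ (-α) ≤ 1 / 2 := by
  have hA0 : 0 < A := lt_of_lt_of_le one_pos hA1
  have hN0 : (0 : ℝ) < N := by exact_mod_cast hN
  have hNα : 0 < (N : ℝ) ^ (1 / α) := Real.rpow_pos_of_pos hN0 _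
  set r₁ : ℝ := A * (N : ℝ) ^ (1 / α) with hr₁
  have hr₁0 : 0 < r₁ := mul_pos hA0 hNα
  have hpow1 : ((N : ℝ) ^ (1 / α)) ^ (-α) = (N : ℝ)⁻¹ := by
    rw [← Real.rpow_mul hN0.le, show (1 / α) * (-α) = -1 by field_simp, Real.rpow_neg_one]
  have hr₁α : r₁ ^ (-α) = A ^ (-α) * (N : ℝ)⁻¹ := by
    rw [hr₁, Real.mul_rpow hA0.le hNα.le, hpow1]
  have hAα : 0 ≤ A ^ (-α) := Real.rpow_nonneg hA0.le _
  have hCT' : C_T * A ^ (-α) ≤ 1 / 2 := by nlinarith [hA, mul_nonneg hc₂' hAα]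
  refine ⟨?_, hCT'⟩
  rcases Nat.eq_zero_or_pos k with h0 | hkpos
  · subst h0; rw [kpow_far_zero hQ0 hr₁0.le v]; positivity
  · calc _ ≤ C_T * k * r₁ ^ (-α) := htail k v r₁ hkpos hr₁0
      _ ≤ C_T * N * r₁ ^ (-α) := by gcongr
      _ = C_T * A ^ (-α) := by rw [hr₁α]; field_simp


/-- **The survival constant.** Given `G ≥ 0` and `A'` there is `A ≥ 1` with `G A^{-α} ≤ 1/2`
and `(1 + A') 3^{1/α} ≤ A`. [folklore] -/
theorem exists_surv_const (hα : 0 < α) {G : ℝ} (hG : 0 ≤ G) (A' : ℝ) :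
    ∃ A : ℝ, 1 ≤ A ∧ G * A ^ (-α) ≤ 1 / 2 ∧ (1 + A') * (3 : ℝ) ^ (1 / α) ≤ A := by
  set A : ℝ := max (max 1 ((2 * G + 1) ^ (1 / α))) ((1 + A') * (3 : ℝ) ^ (1 / α)) with hAdef
  have hA1 : 1 ≤ A := le_trans (le_max_left _ _) (le_max_left _ _)
  have hA0 : 0 < A := lt_of_lt_of_le one_pos hA1
  refine ⟨A, hA1, ?_, le_max_right _ _⟩
  have h1 : (2 * G + 1) ^ (1 / α) ≤ A := le_trans (le_max_right _ _) (le_max_left _ _)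
  have h2 : 2 * G + 1 ≤ A ^ α := by
    calc 2 * G + 1 = ((2 * G + 1) ^ (1 / α)) ^ α := by
          rw [← Real.rpow_mul (by positivity), one_div_mul_cancel hα.ne', Real.rpow_one]
      _ ≤ A ^ α := Real.rpow_le_rpow (by positivity) h1 hα.le
  have hAα : 0 < A ^ α := Real.rpow_pos_of_pos hA0 α
  rw [Real.rpow_neg hA0.le, ← div_eq_mul_inv, div_le_iff₀ hAα]
  nlinarith

/-- **Near-diagonal lower bound (Bass–Levin Prop. 5.1), all times.** For every `A' > 0` there is
`c > 0` with `Q N x y ≥ c N^{-d/α}` whenever `N ≥ 2` and `‖x − y‖ ≤ A' N^{1/α}`.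
[cite: BassLevin2002, Prop. 5.1] -/
theorem kpow_near_diag_lower (hd : 1 ≤ d) (hα : 0 < α) (hP0 : ∀ x y, 0 ≤ P x y)
    (hP1 : ∀ x, HasSum (P x) 1)
    (hμ : ∀ x, m ≤ μ x ∧ μ x ≤ M) (hm : 0 < m)
    (hrev : ∀ x y, μ x * P x y = μ y * P y x)
    (hlb : ∀ x y, c₁ * ‖x - y‖ ^ (-((d : ℝ) + α)) ≤ P x y) (hc₁ : 0 < c₁)
    (hub : ∀ x y, P x y ≤ c₂ * ‖x - y‖ ^ (-((d : ℝ) + α))) (hc₂ : 0 ≤ c₂)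
    (hQ0 : ∀ x y, Q 0 x y = if x = y then 1 else 0)
    (hQ : ∀ n x y, Q (n + 1) x y = ∑' z, Q n x z * P z y)
    {C_T : ℝ} (hCT : 0 ≤ C_T)
    (htail : ∀ (k : ℕ) (x : Fin d → ℤ) (r : ℝ), 1 ≤ k → 0 < r →
      ∑' z, {z | r < ‖z - x‖}.indicator (Q k x) z ≤ C_T * k * r ^ (-α))
    {A' : ℝ} (hA' : 0 < A') :
    ∃ c : ℝ, 0 < c ∧ ∀ (N : ℕ) (x y : Fin d → ℤ), 2 ≤ N → ‖x - y‖ ≤ A' * (N : ℝ) ^ (1 / α) →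
      c * (N : ℝ) ^ (-(d : ℝ) / α) ≤ Q N x y := by
  have hPs : ∀ x, Summable (P x) := fun x => (hP1 x).summable
  have hP1' : ∀ x, ∑' y, P x y ≤ 1 := fun x => ((hP1 x).tsum_eq).le
  have hQnn : ∀ k x w, 0 ≤ Q k x w := kpow_nonneg hP0 hQ0 hQ
  set Ct : ℝ := (2 : ℝ) ^ α * (3 ^ d + 2 * d * 3 ^ (d - 1) / α) with hCt
  have hCtnn : 0 ≤ Ct := by rw [hCt]; positivity
  obtain ⟨A, hA1, hAsurv, hA3⟩ :=
    exists_surv_const hα (G := c₂ * Ct + C_T) (by positivity) A'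
  have hA0 : 0 < A := lt_of_lt_of_le one_pos hA1
  obtain ⟨c, hc, hndlb⟩ := kpow_near_diag_lower_even hd hα hP0 hP1 hμ hm hrev hlb hc₁ hub hc₂
    hQ0 hQ hCT htail hA1 hAsurv
  have hc₁1 : c₁ ≤ 1 := c_one_le_one hd hP0 hP1 hlb
  refine ⟨c₁ * c, mul_pos hc₁ hc, fun N x y hN hxy => ?_⟩
  obtain ⟨n, hn1, hNn, hn3⟩ : ∃ n : ℕ, 1 ≤ n ∧ (N = n + n ∨ N = n + n + 1) ∧ N ≤ 3 * n := by
    rcases Nat.even_or_odd N with ⟨n, hn⟩ | ⟨n, hn⟩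
    · exact ⟨n, by omega, Or.inl hn, by omega⟩
    · exact ⟨n, by omega, Or.inr (by omega), by omega⟩
  have hn0 : (0 : ℝ) < n := by exact_mod_cast hn1
  have hN0 : (0 : ℝ) < N := by exact_mod_cast (by omega : 0 < N)
  have hNn3 : (N : ℝ) ≤ 3 * n := by exact_mod_cast hn3
  have hkey : (1 + A') * (N : ℝ) ^ (1 / α) ≤ A * (n : ℝ) ^ (1 / α) := by
    calc (1 + A') * (N : ℝ) ^ (1 / α) ≤ (1 + A') * (3 * (n : ℝ)) ^ (1 / α) := by gcongr
      _ = (1 + A') * (3 : ℝ) ^ (1 / α) * (n : ℝ) ^ (1 / α) := by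
          rw [Real.mul_rpow (by norm_num) hn0.le]; ring
      _ ≤ A * (n : ℝ) ^ (1 / α) := mul_le_mul_of_nonneg_right hA3 (Real.rpow_nonneg hn0.le _)
  have hexp : -(d : ℝ) / α ≤ 0 := by
    rw [neg_div]; exact neg_nonpos.mpr (div_nonneg (Nat.cast_nonneg d) hα.le)
  have hnN : (N : ℝ) ^ (-(d : ℝ) / α) ≤ (n : ℝ) ^ (-(d : ℝ) / α) :=
    Real.rpow_le_rpow_of_nonpos hn0 (by exact_mod_cast (by omega : n ≤ N)) hexp
  have hN1 : (1 : ℝ) ≤ (N : ℝ) ^ (1 / α) :=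
    Real.one_le_rpow (by exact_mod_cast (by omega : 1 ≤ N)) (by positivity)
  have hnq : 0 ≤ (N : ℝ) ^ (-(d : ℝ) / α) := Real.rpow_nonneg hN0.le _
  rcases hNn with hNe | hNo
  · -- even times
    have hxy' : ‖x - y‖ ≤ A * (n : ℝ) ^ (1 / α) := by
      calc ‖x - y‖ ≤ A' * (N : ℝ) ^ (1 / α) := hxy
        _ ≤ (1 + A') * (N : ℝ) ^ (1 / α) := by gcongr; linarith
        _ ≤ A * (n : ℝ) ^ (1 / α) := hkey
    have h := hndlb n x y hn1 hxy'
    calc c₁ * c * (N : ℝ) ^ (-(d : ℝ) / α) ≤ 1 * c * (n : ℝ) ^ (-(d : ℝ) / α) :=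
          mul_le_mul (mul_le_mul_of_nonneg_right hc₁1 hc.le) hnN hnq (by positivity)
      _ = c * (n : ℝ) ^ (-(d : ℝ) / α) := by ring
      _ ≤ Q (n + n) x y := h
      _ = Q N x y := by rw [hNe]
  · -- odd times: one step to a neighbour, then the even bound
    obtain ⟨i0⟩ : Nonempty (Fin d) := ⟨⟨0, hd⟩⟩
    set e : Fin d → ℤ := Pi.single i0 1 with he
    have hne : ‖e‖ = 1 := by rw [he, Pi.norm_single]; simp
    have hPxw : c₁ ≤ P x (x + e) := by
      have := hlb x (x + e)
      rwa [sub_add_cancel_left, norm_neg, hne, Real.one_rpow, mul_one] at this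
    have hwy : ‖(x + e) - y‖ ≤ A * (n : ℝ) ^ (1 / α) := by
      calc ‖(x + e) - y‖ = ‖e + (x - y)‖ := by congr 1; abel
        _ ≤ ‖e‖ + ‖x - y‖ := norm_add_le _ _
        _ ≤ 1 + A' * (N : ℝ) ^ (1 / α) := by rw [hne]; exact add_le_add le_rfl hxy
        _ ≤ (1 + A') * (N : ℝ) ^ (1 / α) := by nlinarith
        _ ≤ A * (n : ℝ) ^ (1 / α) := hkey
    have h2n := hndlb n (x + e) y hn1 hwy
    have hstep : P x (x + e) * Q (n + n) (x + e) y ≤ Q (n + n + 1) x y := by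
      rw [kpow_succ_left hP0 hPs hP1' hQ0 hQ (n + n) x y]
      exact (summable_kernel_mul_kpow hP0 hPs hP1' hQ0 hQ (n + n) x y).le_tsum (x + e)
        (fun z _ => mul_nonneg (hP0 x z) (hQnn _ z y))
    calc c₁ * c * (N : ℝ) ^ (-(d : ℝ) / α) ≤ c₁ * (c * (n : ℝ) ^ (-(d : ℝ) / α)) := by
          rw [mul_assoc]
          exact mul_le_mul_of_nonneg_left (mul_le_mul_of_nonneg_left hnN hc.le) hc₁.le
      _ ≤ P x (x + e) * Q (n + n) (x + e) y := mul_le_mul hPxw h2n (by positivity) (hP0 x _)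
      _ ≤ Q (n + n + 1) x y := hstep
      _ = Q N x y := by rw [hNo]

/-! ### Off-diagonal lower bound -/

/-- **Landing rate of the first long jump.** If every point `w` of `B(v, r₁)` is at distance in
`(r₁, L]` from `z`, then `(mass of R k v · in B(v,r₁)) · c₁ L^{-(d+α)} ≤ ∑_w R k v w K₂ w z` for the
chain truncated at `r₁` (`K₂` the long jumps). [folklore] -/
theorem tsum_kpow_mul_bigJump_ge (hP0 : ∀ x y, 0 ≤ P x y) (hP1 : ∀ x, HasSum (P x) 1)
    (hlb : ∀ x y, c₁ * ‖x - y‖ ^ (-((d : ℝ) + α)) ≤ P x y) (hc₁ : 0 ≤ c₁)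
    (hαd : 0 ≤ (d : ℝ) + α) {r₁ L : ℝ} (hr₁ : 0 < r₁)
    (hK₁ : ∀ w z, K₁ w z = if ‖w - z‖ ≤ r₁ then P w z else 0)
    {K₂ : (Fin d → ℤ) → (Fin d → ℤ) → ℝ}
    (hK₂ : ∀ w z, K₂ w z = if ‖w - z‖ ≤ r₁ then 0 else P w z)
    (hR0 : ∀ x y, R 0 x y = if x = y then 1 else 0)
    (hR : ∀ n x y, R (n + 1) x y = ∑' z, R n x z * K₁ z y) (v z : Fin d → ℤ) (k : ℕ)
    (hz : ∀ w, ‖w - v‖ ≤ r₁ → r₁ < ‖w - z‖ ∧ ‖w - z‖ ≤ L) :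
    (∑' w, (Metric.closedBall v r₁).indicator (R k v) w) * (c₁ * L ^ (-((d : ℝ) + α))) ≤
      ∑' w, R k v w * K₂ w z := by
  have hPs : ∀ x, Summable (P x) := fun x => (hP1 x).summable
  have hP1' : ∀ x, ∑' y, P x y ≤ 1 := fun x => ((hP1 x).tsum_eq).le
  have hK₁nn : ∀ w z, 0 ≤ K₁ w z := trunc_nonneg hP0 hK₁
  have hK₂nn : ∀ w z, 0 ≤ K₂ w z := bigJump_nonneg hP0 hK₂
  have hK₁s : ∀ w, Summable (K₁ w) := trunc_summable hP0 hPs hK₁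
  have hK₁1 : ∀ w, ∑' z, K₁ w z ≤ 1 := trunc_tsum_le_one hP0 hPs hP1' hK₁
  have hK₂1 : ∀ w z, K₂ w z ≤ 1 := fun w z =>
    (bigJump_le hP0 hK₂ w z).trans (kernel_le_one hP0 hPs hP1' w z)
  have hRnn : ∀ k x w, 0 ≤ R k x w := kpow_nonneg hK₁nn hR0 hR
  set s : ℝ := (d : ℝ) + α with hs
  set θ : ℝ := c₁ * L ^ (-s) with hθ
  have hpt : ∀ w, (Metric.closedBall v r₁).indicator (R k v) w * θ ≤ R k v w * K₂ w z := by
    intro w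
    by_cases hw : w ∈ Metric.closedBall v r₁
    · rw [Set.indicator_of_mem hw]
      rw [Metric.mem_closedBall, dist_eq_norm] at hw
      obtain ⟨hwz1, hwzL⟩ := hz w hw
      refine mul_le_mul_of_nonneg_left ?_ (hRnn k v w)
      have hwzpos : 0 < ‖w - z‖ := lt_trans hr₁ hwz1
      rw [hK₂, if_neg (not_le.mpr hwz1)]
      calc θ = c₁ * L ^ (-s) := rfl
        _ ≤ c₁ * ‖w - z‖ ^ (-s) := mul_le_mul_of_nonneg_left
            (Real.rpow_le_rpow_of_nonpos hwzpos hwzL (by rw [hs]; linarith)) hc₁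
        _ ≤ P w z := hlb w z
    · rw [Set.indicator_of_notMem hw, zero_mul]
      exact mul_nonneg (hRnn k v w) (hK₂nn w z)
  have hsB : Summable fun w => (Metric.closedBall v r₁).indicator (R k v) w * θ :=
    ((kpow_summable hK₁nn hK₁s hK₁1 hR0 hR k v).indicator _).mul_right _
  have hsRK : Summable fun w => R k v w * K₂ w z :=
    (kpow_summable hK₁nn hK₁s hK₁1 hR0 hR k v).of_nonneg_of_le
      (fun w => mul_nonneg (hRnn k v w) (hK₂nn w z))
      (fun w => mul_le_of_le_one_right (hRnn k v w) (hK₂1 w z))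
  calc (∑' w, (Metric.closedBall v r₁).indicator (R k v) w) * θ
      = ∑' w, (Metric.closedBall v r₁).indicator (R k v) w * θ := tsum_mul_right.symm
    _ ≤ ∑' w, R k v w * K₂ w z := Summable.tsum_le_tsum hpt hsB hsRK

/-- **Meyer's decomposition, partial lower bound**: dropping the truncated part and restricting
the time of the first long jump to `T ⊆ {0,…,n-1}` and its landing point to a finite set `F`,
`∑_{k∈T} ∑_{z∈F} (∑_w R k v w K₂ w z) Q (n-1-k) z z' ≤ Q n v z'`. [folklore] -/
theorem kpow_ge_meyer_partial (hP0 : ∀ x y, 0 ≤ P x y) (hP1 : ∀ x, HasSum (P x) 1)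
    {r₁ : ℝ} (hK₁ : ∀ w z, K₁ w z = if ‖w - z‖ ≤ r₁ then P w z else 0)
    {K₂ : (Fin d → ℤ) → (Fin d → ℤ) → ℝ}
    (hK₂ : ∀ w z, K₂ w z = if ‖w - z‖ ≤ r₁ then 0 else P w z)
    (hQ0 : ∀ x y, Q 0 x y = if x = y then 1 else 0)
    (hQ : ∀ n x y, Q (n + 1) x y = ∑' z, Q n x z * P z y)
    (hR0 : ∀ x y, R 0 x y = if x = y then 1 else 0)
    (hR : ∀ n x y, R (n + 1) x y = ∑' z, R n x z * K₁ z y) (n : ℕ) (v z' : Fin d → ℤ)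
    {T : Finset ℕ} (hT : T ⊆ Finset.range n) (F : Finset (Fin d → ℤ)) :
    ∑ k ∈ T, ∑ z ∈ F, (∑' w, R k v w * K₂ w z) * Q (n - 1 - k) z z' ≤ Q n v z' := by
  have hPs : ∀ x, Summable (P x) := fun x => (hP1 x).summable
  have hP1' : ∀ x, ∑' y, P x y ≤ 1 := fun x => ((hP1 x).tsum_eq).le
  have hK₁nn : ∀ w z, 0 ≤ K₁ w z := trunc_nonneg hP0 hK₁
  have hK₂nn : ∀ w z, 0 ≤ K₂ w z := bigJump_nonneg hP0 hK₂
  have hK₁s : ∀ w, Summable (K₁ w) := trunc_summable hP0 hPs hK₁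
  have hK₁1 : ∀ w, ∑' z, K₁ w z ≤ 1 := trunc_tsum_le_one hP0 hPs hP1' hK₁
  have hK₂s : ∀ w, Summable (K₂ w) := bigJump_summable hP0 hPs hK₂
  have hQnn : ∀ k x w, 0 ≤ Q k x w := kpow_nonneg hP0 hQ0 hQ
  have hRnn : ∀ k x w, 0 ≤ R k x w := kpow_nonneg hK₁nn hR0 hR
  have hmeyer := kpow_meyer (K := P) (Q := Q) (K₁ := K₁) (K₂ := K₂) (R := R) hK₁nn hK₂nn
    (trunc_add_bigJump hK₁ hK₂) hPs hP1' hQ0 hQ hR0 hR n v z'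
  have hνnn : ∀ k z, 0 ≤ ∑' w, R k v w * K₂ w z :=
    fun k z => tsum_nonneg fun w => mul_nonneg (hRnn k v w) (hK₂nn w z)
  have hνs : ∀ k, Summable fun z => ∑' w, R k v w * K₂ w z := by
    intro k
    have h1 : ∀ w, Summable fun z => R k v w * K₂ w z := fun w => (hK₂s w).mul_left _
    have h2 : Summable fun w => ∑' z, R k v w * K₂ w z := by
      refine (kpow_summable hK₁nn hK₁s hK₁1 hR0 hR k v).of_nonneg_of_le
        (fun w => tsum_nonneg fun z => mul_nonneg (hRnn k v w) (hK₂nn w z)) (fun w => ?_)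
      rw [tsum_mul_left]
      refine mul_le_of_le_one_right (hRnn k v w) ?_
      exact (Summable.tsum_le_tsum (bigJump_le hP0 hK₂ w) (hK₂s w) (hPs w)).trans (hP1' w)
    exact (summable_swap_of_nonneg (fun w z => mul_nonneg (hRnn k v w) (hK₂nn w z)) h1 h2).2
  have hterm_nn : ∀ k, 0 ≤ ∑' z, (∑' w, R k v w * K₂ w z) * Q (n - 1 - k) z z' :=
    fun k => tsum_nonneg fun z => mul_nonneg (hνnn k z) (hQnn _ z z')
  have hF : ∀ k, ∑ z ∈ F, (∑' w, R k v w * K₂ w z) * Q (n - 1 - k) z z' ≤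
      ∑' z, (∑' w, R k v w * K₂ w z) * Q (n - 1 - k) z z' := by
    intro k
    have hsum : Summable fun z => (∑' w, R k v w * K₂ w z) * Q (n - 1 - k) z z' :=
      (hνs k).of_nonneg_of_le (fun z => mul_nonneg (hνnn k z) (hQnn _ z z'))
        (fun z => mul_le_of_le_one_right (hνnn k z) (kpow_le_one hP0 hPs hP1' hQ0 hQ _ z z'))
    exact hsum.sum_le_tsum F (fun z _ => mul_nonneg (hνnn k z) (hQnn _ z z'))
  calc ∑ k ∈ T, ∑ z ∈ F, (∑' w, R k v w * K₂ w z) * Q (n - 1 - k) z z'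
      ≤ ∑ k ∈ T, ∑' z, (∑' w, R k v w * K₂ w z) * Q (n - 1 - k) z z' :=
        Finset.sum_le_sum fun k _ => hF k
    _ ≤ ∑ k ∈ Finset.range n, ∑' z, (∑' w, R k v w * K₂ w z) * Q (n - 1 - k) z z' :=
        Finset.sum_le_sum_of_subset_of_nonneg hT (fun k _ _ => hterm_nn k)
    _ ≤ R n v z' + ∑ k ∈ Finset.range n, ∑' z, (∑' w, R k v w * K₂ w z) * Q (n - 1 - k) z z' :=
        le_add_of_nonneg_left (hRnn n v z')
    _ = Q n v z' := hmeyer.symm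


/-- **Off-diagonal lower bound (Bass–Levin Thm 5.2, PHI-free).** There are `A'' ≥ 1` and `c > 0`
with `Q N x y ≥ c N ‖x−y‖^{-(d+α)}` whenever `N ≥ 2` and `‖x − y‖ ≥ A'' N^{1/α}`.
For `N ≥ 4`: Meyer's decomposition at `ρ = A N^{1/α}`; the first long jump, from `B(x, ρ)`
(mass `≥ 1/2`, `trunc_kpow_ball_ge_half`) into `B(y, (N/2)^{1/α})` (rate
`≥ c₁(2‖x−y‖)^{-(d+α)}` per point, `tsum_kpow_mul_bigJump_ge`), at any of the first `N/2` steps,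
followed by the near-diagonal lower bound (`kpow_near_diag_lower`). `N = 2, 3` directly from the
kernel bounds. [cite: BassLevin2002, Thm 5.2] -/
theorem kpow_offdiag_lower (hd : 1 ≤ d) (hα : 0 < α) (hP0 : ∀ x y, 0 ≤ P x y)
    (hP1 : ∀ x, HasSum (P x) 1)
    (hμ : ∀ x, m ≤ μ x ∧ μ x ≤ M) (hm : 0 < m)
    (hrev : ∀ x y, μ x * P x y = μ y * P y x)
    (hlb : ∀ x y, c₁ * ‖x - y‖ ^ (-((d : ℝ) + α)) ≤ P x y) (hc₁ : 0 < c₁)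
    (hub : ∀ x y, P x y ≤ c₂ * ‖x - y‖ ^ (-((d : ℝ) + α))) (hc₂ : 0 ≤ c₂)
    (hQ0 : ∀ x y, Q 0 x y = if x = y then 1 else 0)
    (hQ : ∀ n x y, Q (n + 1) x y = ∑' z, Q n x z * P z y)
    {C_T : ℝ} (hCT : 0 ≤ C_T)
    (htail : ∀ (k : ℕ) (x : Fin d → ℤ) (r : ℝ), 1 ≤ k → 0 < r →
      ∑' z, {z | r < ‖z - x‖}.indicator (Q k x) z ≤ C_T * k * r ^ (-α)) :
    ∃ A'' : ℝ, 1 ≤ A'' ∧ ∃ c : ℝ, 0 < c ∧ ∀ (N : ℕ) (x y : Fin d → ℤ), 2 ≤ N →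
      A'' * (N : ℝ) ^ (1 / α) ≤ ‖x - y‖ → c * N * ‖x - y‖ ^ (-((d : ℝ) + α)) ≤ Q N x y := by
  have hPs : ∀ x, Summable (P x) := fun x => (hP1 x).summable
  have hP1' : ∀ x, ∑' y, P x y ≤ 1 := fun x => ((hP1 x).tsum_eq).le
  have hQnn : ∀ k x w, 0 ≤ Q k x w := kpow_nonneg hP0 hQ0 hQ
  set s : ℝ := (d : ℝ) + α with hs
  have hspos : 0 < s := by rw [hs]; positivity
  set Ct : ℝ := (2 : ℝ) ^ α * (3 ^ d + 2 * d * 3 ^ (d - 1) / α) with hCt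
  have hCtnn : 0 ≤ Ct := by rw [hCt]; positivity
  obtain ⟨A, hA1, hAsurv, -⟩ := exists_surv_const hα (G := c₂ * Ct + C_T) (by positivity) 1
  have hA0 : 0 < A := lt_of_lt_of_le one_pos hA1
  obtain ⟨cN, hcN, hnd⟩ := kpow_near_diag_lower hd hα hP0 hP1 hμ hm hrev hlb hc₁ hub hc₂ hQ0 hQ
    hCT htail one_pos
  have hc₁1 : c₁ ≤ 1 := c_one_le_one hd hP0 hP1 hlb
  have hexp : -(d : ℝ) / α ≤ 0 := by
    rw [neg_div]; exact neg_nonpos.mpr (div_nonneg (Nat.cast_nonneg d) hα.le)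
  have h2s1 : (2 : ℝ) ^ (-s) ≤ 1 :=
    Real.rpow_le_one_of_one_le_of_nonpos (by norm_num) (by linarith)
  refine ⟨2 * A + 2, by linarith, ?_⟩
  set cbig : ℝ := c₁ * cN * (2 : ℝ) ^ (-s) * (2 : ℝ) ^ (-(d : ℝ) / α) / 6 with hcbig
  set csmall : ℝ := c₁ ^ 3 * (2 : ℝ) ^ (-s) / 3 with hcsmall
  have hcbig0 : 0 < cbig := by rw [hcbig]; positivity
  have hcsmall0 : 0 < csmall := by rw [hcsmall]; positivity
  refine ⟨min cbig csmall, lt_min hcbig0 hcsmall0, fun N x y hN hD => ?_⟩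
  have hmin0 : 0 ≤ min cbig csmall := (lt_min hcbig0 hcsmall0).le
  set D : ℝ := ‖x - y‖ with hDdef
  have hN0 : (0 : ℝ) < N := by exact_mod_cast (by omega : 0 < N)
  have hNα : 0 < (N : ℝ) ^ (1 / α) := Real.rpow_pos_of_pos hN0 _
  have hD0 : 0 < D := lt_of_lt_of_le (by positivity) hD
  have hxy : x ≠ y := by
    intro h; rw [hDdef, h, sub_self, norm_zero] at hD0; exact lt_irrefl _ hD0
  have hDs : 0 < D ^ (-s) := Real.rpow_pos_of_pos hD0 _
  rcases Nat.lt_or_ge N 4 with hN4 | hN4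
  · -- N = 2 or N = 3 : directly from the kernel bounds
    have hcs : min cbig csmall ≤ csmall := min_le_right _ _
    interval_cases N
    · have h2 := kpow_two_lower hd hα hP0 hP1 hlb hc₁.le hQ0 hQ hxy
      calc min cbig csmall * ((2 : ℕ) : ℝ) * D ^ (-s) ≤ csmall * ((2 : ℕ) : ℝ) * D ^ (-s) := by
            gcongr
        _ = (c₁ * (2 / 3)) * (c₁ ^ 2 * (2 : ℝ) ^ (-s) * D ^ (-s)) := by
            rw [hcsmall]; push_cast; ring
        _ ≤ 1 * (c₁ ^ 2 * (2 : ℝ) ^ (-s) * D ^ (-s)) := by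
            refine mul_le_mul_of_nonneg_right (by nlinarith) (by positivity)
        _ = c₁ ^ 2 * (2 : ℝ) ^ (-s) * ‖x - y‖ ^ (-s) := by rw [one_mul]
        _ ≤ Q 2 x y := h2
    · have h2 := kpow_two_diag_lower hd hP0 hP1 hlb hc₁.le hQ0 hQ x
      have h1 : c₁ * D ^ (-s) ≤ Q 1 x y := by rw [kpow_one hQ0 hQ]; exact hlb x y
      have h3 := kpow_mul_kpow_le_kpow_add hP0 hPs hP1' hQ0 hQ 2 1 x x y
      calc min cbig csmall * ((3 : ℕ) : ℝ) * D ^ (-s) ≤ csmall * ((3 : ℕ) : ℝ) * D ^ (-s) := by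
            gcongr
        _ = (2 : ℝ) ^ (-s) * (c₁ ^ 2 * (c₁ * D ^ (-s))) := by rw [hcsmall]; push_cast; ring
        _ ≤ 1 * (c₁ ^ 2 * (c₁ * D ^ (-s))) :=
            mul_le_mul_of_nonneg_right h2s1 (by positivity)
        _ = c₁ ^ 2 * (c₁ * D ^ (-s)) := one_mul _
        _ ≤ Q 2 x x * Q 1 x y := mul_le_mul h2 h1 (by positivity) (hQnn 2 x x)
        _ ≤ Q (2 + 1) x y := h3
  · -- N ≥ 4 : first long jump into B(y, (N/2)^{1/α}), then the near-diagonal bound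
    have hcb : min cbig csmall ≤ cbig := min_le_left _ _
    set r₁ : ℝ := A * (N : ℝ) ^ (1 / α) with hr₁
    have hr₁0 : 0 < r₁ := mul_pos hA0 hNα
    have hDge : 2 * r₁ + 2 * (N : ℝ) ^ (1 / α) ≤ D := by
      have : (2 * A + 2) * (N : ℝ) ^ (1 / α) = 2 * r₁ + 2 * (N : ℝ) ^ (1 / α) := by rw [hr₁]; ring
      linarith [hD]
    set K₁ : (Fin d → ℤ) → (Fin d → ℤ) → ℝ := fun w z => if ‖w - z‖ ≤ r₁ then P w z else 0
      with hK₁def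
    set K₂ : (Fin d → ℤ) → (Fin d → ℤ) → ℝ := fun w z => if ‖w - z‖ ≤ r₁ then 0 else P w z
      with hK₂def
    have hK₁ : ∀ w z, K₁ w z = if ‖w - z‖ ≤ r₁ then P w z else 0 := fun w z => rfl
    have hK₂ : ∀ w z, K₂ w z = if ‖w - z‖ ≤ r₁ then 0 else P w z := fun w z => rfl
    obtain ⟨R, hR0, hR⟩ := exists_kpow K₁
    have hRnn : ∀ k x w, 0 ≤ R k x w := kpow_nonneg (trunc_nonneg hP0 hK₁) hR0 hR
    have hνnn : ∀ k z, 0 ≤ ∑' w, R k x w * K₂ w z :=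
      fun k z => tsum_nonneg fun w => mul_nonneg (hRnn k x w) (bigJump_nonneg hP0 hK₂ w z)
    -- the target ball around y
    set rB : ℝ := ((N : ℝ) / 2) ^ (1 / α) with hrB
    have hrB0 : 0 < rB := Real.rpow_pos_of_pos (by positivity) _
    have hrBN : rB ≤ (N : ℝ) ^ (1 / α) :=
      Real.rpow_le_rpow (by positivity) (by linarith) (by positivity)
    set tB : ℕ := ⌊rB⌋₊ with htBdef
    have htB : (tB : ℝ) ≤ rB := Nat.floor_le hrB0.le
    have htB1 : rB ≤ 2 * (tB : ℝ) + 1 := by have := Nat.lt_floor_add_one rB; linarith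
    set Bf : Finset (Fin d → ℤ) := (Fintype.piFinset fun _ : Fin d => Finset.Icc (-(tB : ℤ)) tB).map
      (Equiv.addRight y).toEmbedding with hBfdef
    have hBfcard : rB ^ (d : ℝ) ≤ Bf.card := by
      rw [hBfdef, card_box_add]; push_cast; rw [← Real.rpow_natCast]
      exact Real.rpow_le_rpow hrB0.le htB1 (Nat.cast_nonneg d)
    have hBf : ∀ z ∈ Bf, ‖z - y‖ ≤ rB := by
      intro z hz
      rw [hBfdef, mem_box_add_iff] at hz
      exact hz.trans htB
    -- landing rate of the first long jump
    have hland : ∀ z ∈ Bf, ∀ k, k ≤ N →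
        1 / 2 * (c₁ * (2 * D) ^ (-s)) ≤ ∑' w, R k x w * K₂ w z := by
      intro z hz k hk
      have hzy := hBf z hz
      have hgeo : ∀ w, ‖w - x‖ ≤ r₁ → r₁ < ‖w - z‖ ∧ ‖w - z‖ ≤ 2 * D := by
        intro w hw
        constructor
        · have : D ≤ ‖x - w‖ + ‖w - z‖ + ‖z - y‖ := by
            calc D = ‖(x - w) + (w - z) + (z - y)‖ := by rw [hDdef]; congr 1; abel
              _ ≤ ‖(x - w) + (w - z)‖ + ‖z - y‖ := norm_add_le _ _
              _ ≤ ‖x - w‖ + ‖w - z‖ + ‖z - y‖ := by gcongr; exact norm_add_le _ _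
          rw [norm_sub_rev x w] at this
          linarith
        · calc ‖w - z‖ = ‖(w - x) + (x - y) + (y - z)‖ := by congr 1; abel
            _ ≤ ‖(w - x) + (x - y)‖ + ‖y - z‖ := norm_add_le _ _
            _ ≤ ‖w - x‖ + ‖x - y‖ + ‖y - z‖ := by gcongr; exact norm_add_le _ _
            _ ≤ r₁ + D + rB := by
                rw [norm_sub_rev y z]; exact add_le_add (add_le_add hw le_rfl) hzy
            _ ≤ 2 * D := by linarith
      have h1 := tsum_kpow_mul_bigJump_ge hP0 hP1 hlb hc₁.le hspos.le hr₁0 hK₁ hK₂ hR0 hR x z k hgeo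
      have h2 := trunc_kpow_ball_ge_half hd hα hP0 hP1 hub hc₂ hQ0 hQ hCT htail hA1 hAsurv
        (by omega : 1 ≤ N) hK₁ hR0 hR x k hk
      calc 1 / 2 * (c₁ * (2 * D) ^ (-s))
          ≤ (∑' w, (Metric.closedBall x r₁).indicator (R k x) w) * (c₁ * (2 * D) ^ (-s)) :=
            mul_le_mul_of_nonneg_right h2 (by positivity)
        _ ≤ ∑' w, R k x w * K₂ w z := h1
    -- the near-diagonal lower bound for the remaining steps
    have hrest : ∀ k ∈ Finset.range (N / 2), ∀ z ∈ Bf,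
        cN * (N : ℝ) ^ (-(d : ℝ) / α) ≤ Q (N - 1 - k) z y := by
      intro k hk z hz
      have hk' : k < N / 2 := Finset.mem_range.mp hk
      have hj2 : 2 ≤ N - 1 - k := by omega
      have hjN : N - 1 - k ≤ N := by omega
      have hj0 : (0 : ℝ) < ((N - 1 - k : ℕ) : ℝ) := by exact_mod_cast (by omega : 0 < N - 1 - k)
      have hjhalf : (N : ℝ) / 2 ≤ ((N - 1 - k : ℕ) : ℝ) := by
        have h' : N ≤ 2 * (N - 1 - k) := by omega
        have : (N : ℝ) ≤ 2 * ((N - 1 - k : ℕ) : ℝ) := by exact_mod_cast h'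
        linarith
      have hzy : ‖z - y‖ ≤ 1 * ((N - 1 - k : ℕ) : ℝ) ^ (1 / α) := by
        rw [one_mul]
        calc ‖z - y‖ ≤ rB := hBf z hz
          _ ≤ ((N - 1 - k : ℕ) : ℝ) ^ (1 / α) :=
              Real.rpow_le_rpow (by positivity) hjhalf (by positivity)
      calc cN * (N : ℝ) ^ (-(d : ℝ) / α) ≤ cN * ((N - 1 - k : ℕ) : ℝ) ^ (-(d : ℝ) / α) :=
            mul_le_mul_of_nonneg_left
              (Real.rpow_le_rpow_of_nonpos hj0 (by exact_mod_cast hjN) hexp) hcN.le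
        _ ≤ Q (N - 1 - k) z y := hnd (N - 1 - k) z y hj2 hzy
    -- sum over jump times k < N/2 and landing points z ∈ Bf
    have hpart := kpow_ge_meyer_partial hP0 hP1 hK₁ hK₂ hQ0 hQ hR0 hR N x y
      (T := Finset.range (N / 2)) (Finset.range_mono (Nat.div_le_self N 2)) Bf
    have hsum : ((N / 2 : ℕ) : ℝ) * Bf.card *
        (1 / 2 * (c₁ * (2 * D) ^ (-s)) * (cN * (N : ℝ) ^ (-(d : ℝ) / α))) ≤
        ∑ k ∈ Finset.range (N / 2), ∑ z ∈ Bf, (∑' w, R k x w * K₂ w z) * Q (N - 1 - k) z y := by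
      calc ((N / 2 : ℕ) : ℝ) * Bf.card *
            (1 / 2 * (c₁ * (2 * D) ^ (-s)) * (cN * (N : ℝ) ^ (-(d : ℝ) / α)))
          = ∑ k ∈ Finset.range (N / 2), ∑ z ∈ Bf,
              1 / 2 * (c₁ * (2 * D) ^ (-s)) * (cN * (N : ℝ) ^ (-(d : ℝ) / α)) := by
            rw [Finset.sum_const, Finset.card_range, nsmul_eq_mul, Finset.sum_const, nsmul_eq_mul]
            ring
        _ ≤ _ := Finset.sum_le_sum fun k hk => Finset.sum_le_sum fun z hz =>
            mul_le_mul (hland z hz k (by have := Finset.mem_range.mp hk; omega))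
              (hrest k hk z hz) (by positivity) (hνnn k z)
    -- numerics
    have hhalf : (N : ℝ) / 3 ≤ ((N / 2 : ℕ) : ℝ) := by
      have h' : N ≤ 3 * (N / 2) := by omega
      have : (N : ℝ) ≤ 3 * ((N / 2 : ℕ) : ℝ) := by exact_mod_cast h'
      linarith
    have hrBd : rB ^ (d : ℝ) = (2 : ℝ) ^ (-(d : ℝ) / α) * (N : ℝ) ^ ((d : ℝ) / α) := by
      rw [hrB, ← Real.rpow_mul (by positivity), Real.div_rpow hN0.le (by norm_num),
        div_eq_mul_inv, ← Real.rpow_neg (by norm_num : (0 : ℝ) ≤ 2), mul_comm]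
      congr 1
      · congr 1; ring
      · congr 1; ring
    have h2D : (2 * D) ^ (-s) = (2 : ℝ) ^ (-s) * D ^ (-s) := Real.mul_rpow (by norm_num) hD0.le
    have hNN : (N : ℝ) ^ ((d : ℝ) / α) * (N : ℝ) ^ (-(d : ℝ) / α) = 1 := by
      rw [← Real.rpow_add hN0, neg_div, add_neg_cancel, Real.rpow_zero]
    have hid : cbig * N * D ^ (-s) = (N : ℝ) / 3 * ((2 : ℝ) ^ (-(d : ℝ) / α) * (N : ℝ) ^ ((d : ℝ) / α)) *
        (1 / 2 * (c₁ * ((2 : ℝ) ^ (-s) * D ^ (-s))) * (cN * (N : ℝ) ^ (-(d : ℝ) / α))) := by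
      have : (N : ℝ) / 3 * ((2 : ℝ) ^ (-(d : ℝ) / α) * (N : ℝ) ^ ((d : ℝ) / α)) *
          (1 / 2 * (c₁ * ((2 : ℝ) ^ (-s) * D ^ (-s))) * (cN * (N : ℝ) ^ (-(d : ℝ) / α))) =
          cbig * N * D ^ (-s) * ((N : ℝ) ^ ((d : ℝ) / α) * (N : ℝ) ^ (-(d : ℝ) / α)) := by
        rw [hcbig]; ring
      rw [this, hNN, mul_one]
    calc min cbig csmall * N * ‖x - y‖ ^ (-s) ≤ cbig * N * D ^ (-s) := by rw [← hDdef]; gcongr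
      _ = (N : ℝ) / 3 * ((2 : ℝ) ^ (-(d : ℝ) / α) * (N : ℝ) ^ ((d : ℝ) / α)) *
          (1 / 2 * (c₁ * ((2 : ℝ) ^ (-s) * D ^ (-s))) * (cN * (N : ℝ) ^ (-(d : ℝ) / α))) := hid
      _ ≤ ((N / 2 : ℕ) : ℝ) * Bf.card *
          (1 / 2 * (c₁ * (2 * D) ^ (-s)) * (cN * (N : ℝ) ^ (-(d : ℝ) / α))) := by
          rw [h2D, ← hrBd]
          refine mul_le_mul_of_nonneg_right (mul_le_mul hhalf hBfcard (by positivity)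
            (Nat.cast_nonneg _)) (by positivity)
      _ ≤ ∑ k ∈ Finset.range (N / 2), ∑ z ∈ Bf, (∑' w, R k x w * K₂ w z) * Q (N - 1 - k) z y := hsum
      _ ≤ Q N x y := hpart

end Literature.Probability.Process
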